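import Mathlib
import Summits.ResolutionOfSingularities.ResolutionOfSingularities.Theses.Valuative
import Summits.ResolutionOfSingularities.ResolutionOfSingularities.Theorems.ValuativeLuAlphaPTorsorDenseRangeFinal
import Literature.AlgebraicGeometry.Resolution.LocalUniformization
import Literature.AlgebraicGeometry.Resolution.RankOneReductionProofs
import Literature.AlgebraicGeometry.Resolution.CompositeValuations
import Literature.AlgebraicGeometry.Resolution.AffineDomainDimension
import Literature.AlgebraicGeometry.Resolution.TranscendenceDefect
import Literature.AlgebraicGeometry.Resolution.MuPTorsorLocalUniformizationRelative
import HarnessLib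

/-!
# ToricLadderCells — decomp-res node «ToricLadder» (lens-1 g14 ArchimedeanLadder → g15 DensityLadder → g16
ToricLadder), tree file 1/5

Content VERBATIM from the decomp-res lens-1 g16 file `HOME/decomp-res-lens-1/g16/ToricLadder.lean` (sha256
67376591e05ef26e…; PARTS I–II =
g15 `DensityLadder.lean` @6c32844d l.120–1091 = g14 `ArchimedeanLadder.lean` PART I, all carried verbatim by the
lens), namespace renamed
`…Theses.ToricLadder` ↦ `…Theorems.ToricLadder` (ONE namespace for all five tree files so the lens's
dot-notation and unqualified references
stay verbatim), `set_option` lines dropped.  HOME = run/shared/lean/pub/decomp-res.  Landed by decomp-res writer g6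
as SUPPORT of the
Valuative route item 0641 `LuAlphaPTorsor` (critic rows 113/116 + order 2026-08-30T17:45:44Z: g16 supersedes g15 for
landing; lens-1 WRITER.md);
no Valuative route edit is made by the decomp-res cell (the located residual `NonToricArchLU 2 4` and the port
`ToricAscent 2` stay tree
definitions here, documented, for the Valuative tenure / operator to book).  Two elementary lemmas that restate
landed declarations are
deleted and cited BY NAME instead (gate dedup, p782367): `mem_of_mem_nonunits_of_le` (≡
`WildSymbol.Birth.nonunits_subset_of_le`, whose module is not importable here) ↦ its one-line Mathlib proof
inlined at the single use, `algebraMap_mem_of_le` ↦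
`Literature.AlgebraicGeometry.Resolution.algebraMap_mem_of_le`.

PART I §1 the graded statements (`LURel d`, `ArchLU`, `TransResidueLU`, `CompositeLU`, … as `def … : Prop`), §2 elementary
valuation lemmas, §3 transcendence-degree bookkeeping.  Kernels: `ToricLadderKernels`; host/route links:
`ToricLadderLinks`; PART II: `ToricLadderDense`;
PART III (the toric cut): `ToricLadder`.
(Sources: CossartPiltant2019; KnafKuhlmann2005 arXiv:math/0304159 Thm 4.1 + §4 remarks (1)–(3); KnafKuhlmann2009
arXiv:math/0702856 Prop 3.11, Thm 1.5; SanSaturnino2017 arXiv:1412.7697 Thm 7.5; NovacoskiSpivakovsky2014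
arXiv:1204.4751; ZariskiSamuelII.)

The lens's 160-line NODE docstring (host, mechanism, the inhabitant Γ = ℤ[1/p] ⊕ ℤ√2 ⊕ ℤ√3, sources
with page numbers, problem-relative
novelty) is NOT repeated here: HOME/decomp-res-lens-1/g16/ToricLadder.lean l.9–166 and NODE-g16.md (pins in parts/SHA256SUMS).
-/

noncomputable section

open IsLocalRing Literature.AlgebraicGeometry.Resolution
open Summit.ResolutionOfSingularities.ResolutionOfSingularities.Theses
open Summit.ResolutionOfSingularities.ResolutionOfSingularities.Theorems
open Summit.ResolutionOfSingularities.ResolutionOfSingularities.Theorems.PfaffLine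

namespace Summit.ResolutionOfSingularities.ResolutionOfSingularities.Theorems.ToricLadder

/-! # PART I — the archimedean ladder (gen 14, verbatim) -/

/-! ## 1. The graded statements -/

/-- The route's `LUrel_p` (hypothesis of `Valuative.PatchingRel`, conclusion of `Valuative.TorsorToLurel`,
first conjunct of `Valuative.ValuativeThesisRel`), verbatim. -/
def LurelP (p : ℕ) : Prop :=
  ∀ (k K : Type) [Field k] [CharP k p] [Field K] [Algebra k K], (⊤ : IntermediateField k K).FG →
    ∀ O : ValuationSubring K, (∀ c : k, algebraMap k K c ∈ O) → ∀ R : Subalgebra k K, R.FG →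
    R.toSubring ≤ O.toSubring → ∃ (A : Subalgebra k K) (h : A.toSubring ≤ O.toSubring),
      R ≤ A ∧ A.FG ∧ IsFractionRing A K ∧
      IsRegularLocalRing (Localization.AtPrime (Ideal.comap (Subring.inclusion h) (IsLocalRing.maximalIdeal O)))

/-- RUNG `d` (tag UNDECIDED for `d ≥ 4`, piece 0 for `d ≤ 3`): relative local uniformization in
characteristic `p > 0` for all function fields of transcendence degree `≤ d`. -/
def LURel (d : ℕ) : Prop :=
  ∀ p : ℕ, p.Prime → ∀ (k K : Type) [Field k] [CharP k p] [Field K] [Algebra k K],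
    Algebra.trdeg k K ≤ d → ∀ O : ValuationSubring K, RelLocalUniformization k K O

/-- CELL (decided one rung down: `transResidueLU_succ`): valuation rings with an element of
transcendental residue (`f(y)` is an `O`-unit for every non-zero `f ∈ k[X]`). -/
def TransResidueLU (d : ℕ) : Prop :=
  ∀ p : ℕ, p.Prime → ∀ (k K : Type) [Field k] [CharP k p] [Field K] [Algebra k K],
    Algebra.trdeg k K ≤ d → ∀ O : ValuationSubring K,
    (∃ y ∈ O, ∀ f : Polynomial k, f ≠ 0 → O.valuation (Polynomial.aeval y f) = 1) →
    RelLocalUniformization k K O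

/-- CELL (decided one rung down: `compositeLU_succ`): composite valuation rings `O < O₁ < K`. -/
def CompositeLU (d : ℕ) : Prop :=
  ∀ p : ℕ, p.Prime → ∀ (k K : Type) [Field k] [CharP k p] [Field K] [Algebra k K],
    Algebra.trdeg k K ≤ d → ∀ O : ValuationSubring K,
    (∃ O₁ : ValuationSubring K, O ≤ O₁ ∧ O₁ ≠ O ∧ O₁ ≠ ⊤) → RelLocalUniformization k K O

/-- RESIDUAL PIECE (tag UNDECIDED · WEAKER than the root · located residual at `d = 4`): the
archimedean core — rank-one, zero-dimensional valuation rings of function fields of transcendence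
degree `≤ d`. -/
def ArchCoreLU (d : ℕ) : Prop :=
  ∀ p : ℕ, p.Prime → ∀ (k K : Type) [Field k] [CharP k p] [Field K] [Algebra k K],
    Algebra.trdeg k K ≤ d → ∀ O : ValuationSubring K, Nonempty O.valuation.RankOne →
    (∀ y ∈ O, ∃ f : Polynomial k, f ≠ 0 ∧ Polynomial.aeval y f ∈ O.nonunits) →
    RelLocalUniformization k K O

/-- `luRel_mono`: Auxiliary step of this node's calculus, VERBATIM from the lens file (see the module docstring); the statement is its type. [folklore] -/
theorem luRel_mono {d e : ℕ} (hde : d ≤ e) (h : LURel e) : LURel d :=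
  fun p hp k K _ _ _ _ hd O => h p hp k K (hd.trans (by exact_mod_cast hde)) O

/-- `archCoreLU_of_luRel`: Auxiliary step of this node's calculus, VERBATIM from the lens file (see the module docstring); the statement is its type. [folklore] -/
theorem archCoreLU_of_luRel {d : ℕ} (h : LURel d) : ArchCoreLU d :=
  fun p hp k K _ _ _ _ hd O _ _ => h p hp k K hd O

/-- `transResidueLU_of_luRel`: Auxiliary step of this node's calculus, VERBATIM from the lens file (see the module docstring); the statement is its type. [folklore] -/
theorem transResidueLU_of_luRel {d : ℕ} (h : LURel d) : TransResidueLU d :=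
  fun p hp k K _ _ _ _ hd O _ => h p hp k K hd O

/-- `compositeLU_of_luRel`: Auxiliary step of this node's calculus, VERBATIM from the lens file (see the module docstring); the statement is its type. [folklore] -/
theorem compositeLU_of_luRel {d : ℕ} (h : LURel d) : CompositeLU d :=
  fun p hp k K _ _ _ _ hd O _ => h p hp k K hd O

/-! ## 2. Elementary valuation lemmas -/

section Elementary

variable {k K : Type} [Field k] [Field K] [Algebra k K]

/-- `f(y) ∈ O` for `y ∈ O ⊇ k`. [folklore] -/
theorem aeval_mem (O : ValuationSubring K) (hk : ∀ c : k, algebraMap k K c ∈ O) {y : K}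
    (hy : y ∈ O) (f : Polynomial k) : Polynomial.aeval y f ∈ O := by
  let Ok : Subalgebra k K := { O.toSubring with algebraMap_mem' := hk }
  have h : Polynomial.aeval y f = Ok.val (Polynomial.aeval (⟨y, hy⟩ : Ok) f) := by
    rw [← Polynomial.aeval_algHom_apply]; rfl
  rw [h]
  exact (Polynomial.aeval (⟨y, hy⟩ : Ok) f).2

/-- An element all of whose non-trivial polynomial values are units is transcendental. [folklore] -/
theorem transcendental_of_valuation_aeval (O : ValuationSubring K) {y : K}
    (hy : ∀ f : Polynomial k, f ≠ 0 → O.valuation (Polynomial.aeval y f) = 1) :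
    Transcendental k y := by
  rintro ⟨f, hf0, hf⟩
  have h := hy f hf0
  rw [hf, map_zero] at h
  exact zero_ne_one h

/-- **Transcendental residue of a proper coarsening.** If `k ⊆ O < O₁` then any `z ∈ O₁ ∖ O` has
transcendental residue in `κ(O₁)`: `f(z)` is an `O₁`-unit for every non-zero `f ∈ k[X]`
(valuation rings are integrally closed). [folklore] -/
theorem valuation_aeval_eq_one_of_not_mem {O O₁ : ValuationSubring K} (hO : O ≤ O₁)
    (hk : ∀ c : k, algebraMap k K c ∈ O) {z : K} (hz₁ : z ∈ O₁) (hzO : z ∉ O)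
    (f : Polynomial k) (hf0 : f ≠ 0) : O₁.valuation (Polynomial.aeval z f) = 1 := by
  classical
  have hk₁ : ∀ c : k, algebraMap k K c ∈ O₁ := fun c => hO (hk c)
  have hmem : Polynomial.aeval z f ∈ O₁ := aeval_mem O₁ hk₁ hz₁ f
  by_contra hne
  have hlt : O₁.valuation (Polynomial.aeval z f) < 1 :=
    lt_of_le_of_ne ((O₁.valuation_le_one_iff _).mpr hmem) hne
  have hbO : Polynomial.aeval z f ∈ O :=
    O.nonunits_subset <| (ValuationSubring.nonunits_le_nonunits.mpr hO) ((ValuationSubring.mem_nonunits_iff _).mpr hlt)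
  -- the leading coefficient `c ≠ 0`; the constant case is impossible
  have hc : f.leadingCoeff ≠ 0 := Polynomial.leadingCoeff_ne_zero.mpr hf0
  by_cases hdeg : f.natDegree = 0
  · -- `f = C c`, `f(z) = c` is a unit of `O₁`
    have hf : f = Polynomial.C f.leadingCoeff := by
      conv_lhs => rw [Polynomial.eq_C_of_natDegree_eq_zero hdeg]
      rw [Polynomial.leadingCoeff, hdeg]
    apply hne
    rw [hf, Polynomial.aeval_C]
    apply le_antisymm ((O₁.valuation_le_one_iff _).mpr (hk₁ _))
    have h1 := (O₁.valuation_le_one_iff _).mpr (hk₁ f.leadingCoeff⁻¹)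
    rw [map_inv₀, map_inv₀, inv_le_one₀] at h1
    · exact h1
    · rw [Valuation.pos_iff]; simpa using hc
  -- `z` is integral over `O`: root of `f - f(z)` with unit leading coefficient
  letI := algebraOfMem k O hk
  haveI := isScalarTower_algebraOfMem k O hk
  set b : O := ⟨Polynomial.aeval z f, hbO⟩ with hb
  set g : Polynomial O := (f.map (algebraMap k O)) - Polynomial.C b with hg
  have hgz : Polynomial.aeval z g = 0 := by
    rw [hg, map_sub, Polynomial.aeval_map_algebraMap, Polynomial.aeval_C, sub_eq_zero]
    rfl
  have hdegf : 0 < (f.map (algebraMap k O)).degree := by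
    rw [Polynomial.degree_map_eq_of_injective (FaithfulSMul.algebraMap_injective k O)]
    exact Polynomial.natDegree_pos_iff_degree_pos.mp (Nat.pos_of_ne_zero hdeg)
  have hlead : g.leadingCoeff = algebraMap k O f.leadingCoeff := by
    rw [hg, Polynomial.leadingCoeff_sub_of_degree_lt, Polynomial.leadingCoeff_map_of_injective
      (FaithfulSMul.algebraMap_injective k O)]
    exact (Polynomial.degree_C_le).trans_lt hdegf
  have hunit : IsUnit g.leadingCoeff := by
    rw [hlead]; exact (IsUnit.mk0 _ hc).map _
  have hint : IsIntegral O (g.leadingCoeff • z) := isIntegral_leadingCoeff_smul (p := g) (x := z) hgz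
  have hint' : IsIntegral O z := by
    obtain ⟨u, hu⟩ := hunit
    have : z = ((↑u⁻¹ : O) : O) • (g.leadingCoeff • z) := by
      rw [← hu, smul_smul, Units.inv_mul, one_smul]
    rw [this]
    exact hint.smul _
  obtain ⟨w, hw⟩ := IsIntegrallyClosed.isIntegral_iff.mp hint'
  exact hzO (hw ▸ w.2)

/-- A proper coarsening `O < O₁` (with `k ⊆ O`) has an element of transcendental residue. [folklore] -/
theorem exists_transResidue_of_lt {O O₁ : ValuationSubring K} (hO : O ≤ O₁) (hne : O₁ ≠ O)
    (hk : ∀ c : k, algebraMap k K c ∈ O) :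
    ∃ z ∈ O₁, ∀ f : Polynomial k, f ≠ 0 → O₁.valuation (Polynomial.aeval z f) = 1 := by
  obtain ⟨z, hz₁, hzO⟩ : ∃ z ∈ O₁, z ∉ O := by
    by_contra hcon
    push Not at hcon
    exact hne (le_antisymm (fun x hx => hcon x hx) hO)
  exact ⟨z, hz₁, fun f hf0 => valuation_aeval_eq_one_of_not_mem hO hk hz₁ hzO f hf0⟩

/-- Over a model, "no element of transcendental residue" means zero-dimensional. [folklore] -/
theorem zeroDim_of_not_exists (O : ValuationSubring K) (hk : ∀ c : k, algebraMap k K c ∈ O)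
    (h : ¬ ∃ y ∈ O, ∀ f : Polynomial k, f ≠ 0 → O.valuation (Polynomial.aeval y f) = 1) :
    ∀ y ∈ O, ∃ f : Polynomial k, f ≠ 0 ∧ Polynomial.aeval y f ∈ O.nonunits := by
  intro y hy
  push Not at h
  obtain ⟨f, hf0, hf⟩ := h y hy
  refine ⟨f, hf0, (ValuationSubring.mem_nonunits_iff _).mpr ?_⟩
  exact lt_of_le_of_ne ((O.valuation_le_one_iff _).mpr (aeval_mem O hk hy f)) hf

end Elementary

/-! ## 3. Transcendence-degree bookkeeping -/

section Trdeg

variable {k K : Type} [Field k] [Field K] [Algebra k K]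

/-- Tower law: adjoining a transcendental to the ground field drops the transcendence degree. [folklore] -/
theorem trdeg_le_of_transcendental (k' : IntermediateField k K) {y : K} (hy : y ∈ k')
    (hty : Transcendental k y) {d : ℕ} (hd : Algebra.trdeg k K ≤ (d + 1 : ℕ)) :
    Algebra.trdeg k' K ≤ d := by
  have hty' : Transcendental k (⟨y, hy⟩ : k') :=
    (transcendental_algebraMap_iff (FaithfulSMul.algebraMap_injective k' K)).mp hty
  haveI : Algebra.Transcendental k k' := ⟨⟨⟨y, hy⟩, hty'⟩⟩
  have h1 : Algebra.trdeg k k' + Algebra.trdeg k' K ≤ Algebra.trdeg k K := trdeg_add_le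
  have h2 : 1 ≤ Algebra.trdeg k k' := Cardinal.one_le_iff_pos.mpr (trdeg_pos k k')
  have h3 : 1 + Algebra.trdeg k' K ≤ (d + 1 : ℕ) :=
    ((add_le_add h2 le_rfl).trans h1).trans hd
  have hfin : Algebra.trdeg k' K < Cardinal.aleph0 :=
    lt_of_le_of_lt (le_add_self.trans h3) (Cardinal.natCast_lt_aleph0)
  obtain ⟨m, hm⟩ := Cardinal.lt_aleph0.mp hfin
  rw [hm] at h3 ⊢
  have h5 : 1 + m ≤ d + 1 := by exact_mod_cast h3
  exact_mod_cast (by omega : m ≤ d)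

end Trdeg

end Summit.ResolutionOfSingularities.ResolutionOfSingularities.Theorems.ToricLadder
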